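import Summits.ResolutionOfSingularities.ResolutionOfSingularities.Theorems.MarkedTransferCampaignW46MohWindowSurfaceChildCount
import Summits.ResolutionOfSingularities.ResolutionOfSingularities.Theorems.MarkedTransferCampaignW46MohWindowSurfacePermissible
import Summits.ResolutionOfSingularities.ResolutionOfSingularities.Theorems.MarkedTransferCampaignW46MohWindowSurfacePerfect
import HarnessLib

/-!
# [OURS · L1 W4.6 rung (iii-2), TAME SIDE, EVERY `p`] Surface Moh window — THE EXIT BOUND OF THE TAME RUNG: every permissible
# sequence inside the tame purely inseparable surface window has length `≤ Σ_{ξ ∈ Sing(E₀)} (4p − 1)^{residual order of J_ξ}`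
# (cell res-hironaka, LADDER-RESOLUTION rung L, D-0089; seat res-L1-s46-pv-5 gen 5; host MarkedTransfer,
# `--supports stmt-ResolutionOfSingularities-16155 --as helper`; statement file `…CampaignW46MohWindowSurface.lean`)

HONEST FRAMING. Nothing here is a statement of H. Hironaka's manuscript [Hironaka2017] and nothing here asserts that any
statement of it holds. THEOREMS about the OURS regime `CampaignW46.Regime.mohWindowSurfaceTame` (o1 §5) for EVERY prime `p` and
every field `K` of characteristic `p`: the EXIT-BOUND FORM `FinLocalExitBound (Regime.mohWindowSurfaceTame)` (rung (i-a)′'s shape),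
for which o1's statement file recorded «no exit-bound form is typed (prover: «the multiset argument gives no honest numeric β without
a child-count lemma — later»)». The child-count lemma is `…ChildCount.lean` (at most `N = 2(2p − 1)` singular points over an
admitted centre); with res-D-pv-050 AS res-L1-s46-pv-12's one-step laws (`residualOrder_lt_of_over_centre`: the residual order
drops over the centre in the tame regime; `residualOrder_eq_of_not_over_centre`: transported off it) the POTENTIAL
`Φ(E) = Σ_{ξ ∈ Sing(E)} (N + 1)^{residualOrder(J_ξ)}` drops by at least `1` at every admitted blow-up, so every in-regime permissible
sequence has length `≤ Φ(E₀)`. AI-written; AI review is weaker than expert review. No `sorry`; axioms standard.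

WHAT IS PROVED.
* `sum_pow_val_succ_add_one_le` — abstract potential step with branching bound `N`: weights transported off the centre, dropping
  over it, at most `N` singular points over the centre ⇒ `Σ_{Sing(E′)} (N+1)^{val′} + 1 ≤ Σ_{Sing(E)} (N+1)^{val}`.
* `FinPermissibleRun.len_le_potential_of_mohWindowSurfaceTame` — **every finite §2.1-permissible sequence inside
  `Regime.mohWindowSurfaceTame` has `len ≤ Σ_{ξ ∈ Sing(E₀)} (4p − 1)^{residualOrder(J_ξ)}`**.
* `residualOrder_toNat_le_of_mohWindowSurface` (`≤ 2p − 1`), `FinPermissibleRun.len_le_ncard_mul_pow_of_mohWindowSurfaceTame`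
  (**`len ≤ #Sing(E₀) · (4p − 1)^(2p − 1)`**), `finLocalExitBound_mohWindowSurfaceTame`, `finLocalExitBound_mohWindowSurfaceTamePerfect`
  — the EXIT-BOUND FORM of the tame rung (`β(A, E, x) = #Sing(E) · (4p − 1)^(2p − 1)`), every `p`, every `K`.
  [ZariskiSamuel1960] [Matsumura1987] [HauserWagner2014] [CossartPiltant2008]
-/

noncomputable section

set_option linter.dupNamespace false -- mandated namespace of this single-conjunct summit

open CategoryTheory AlgebraicGeometry TopologicalSpace IsLocalRing

namespace Summit.ResolutionOfSingularities.ResolutionOfSingularities.Theorems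

namespace CampaignW46

open Literature.AlgebraicGeometry.Resolution
open Literature.AlgebraicGeometry.Hironaka2017.S02Preliminaries
open Literature.AlgebraicGeometry.Hironaka2017.Datum
open Literature.AlgebraicGeometry.Hironaka2017.S16Proof
open Scheme.IdealSheafData

universe u

section Campaign

variable {p : ℕ} [Fact p.Prime] {K : Type u} [Field K] [CharP K p]
variable {A A' : AmbientDatum p K} {E : IdealExponent A.Z}

/-! ## 1. The abstract potential step with a branching bound -/

/-- **Abstract potential step with branching bound `N`.** For a permissible blow-up with `Sing(E)` a finite set of closed points
and `Sing(E′)` finite, weights `val, val′` TRANSPORTED off the centre and DROPPING over it, and at most `N` singular points of `E′`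
over the centre: `Σ_{Sing(E′)} (N+1)^{val′} + 1 ≤ Σ_{Sing(E)} (N+1)^{val}`. [folklore] -/
theorem sum_pow_val_succ_add_one_le {D : Closeds A.Z} (π : A'.Z ⟶ A.Z)
    (hπ : IsBlowup π (vanishingIdeal D)) (hD : E.IsPermissibleCentre A.hom D) (hfin : E.sing.Finite)
    (hcl : E.sing ⊆ Literature.AlgebraicGeometry.Hironaka2017.S02Preliminaries.closedPoints A.Z)
    (hfin' : (E.transform π D).sing.Finite) (val : A.Z → ℕ) (val' : A'.Z → ℕ)
    (hoff : ∀ x' ∈ (E.transform π D).sing, π.base x' ∉ (D : Set A.Z) → val' x' = val (π.base x'))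
    (hon : ∀ x' ∈ (E.transform π D).sing, π.base x' ∈ (D : Set A.Z) → val' x' < val (π.base x')) (N : ℕ)
    (hN : ((E.transform π D).sing ∩ π.base ⁻¹' (D : Set A.Z)).Finite ∧
      ((E.transform π D).sing ∩ π.base ⁻¹' (D : Set A.Z)).ncard ≤ N) :
    (∑ x' ∈ hfin'.toFinset, (N + 1) ^ val' x') + 1 ≤ ∑ x ∈ hfin.toFinset, (N + 1) ^ val x := by
  classical
  obtain ⟨ξ, hξS, hξcl, hDξ⟩ := IsPermissibleCentre.exists_eq_singleton_of_isolatedSing hD ⟨hfin, hcl⟩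
  set S : Finset A.Z := hfin.toFinset with hS
  set S' : Finset A'.Z := hfin'.toFinset with hS'
  set Son : Finset A'.Z := S'.filter fun x' => π.base x' = ξ with hSon
  set Soff : Finset A'.Z := S'.filter fun x' => ¬ π.base x' = ξ with hSoff
  have hξmem : ξ ∈ S := by rw [hS, Set.Finite.mem_toFinset]; exact hξS
  have hmemS' : ∀ x', x' ∈ S' ↔ x' ∈ (E.transform π D).sing := fun x' => by rw [hS', Set.Finite.mem_toFinset]
  have hsplit : ∑ x' ∈ S', (N + 1) ^ val' x' = ∑ x' ∈ Soff, (N + 1) ^ val' x' + ∑ x' ∈ Son, (N + 1) ^ val' x' := by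
    rw [hSoff, hSon, ← Finset.sum_filter_add_sum_filter_not S' (fun x' => π.base x' = ξ) (fun x' => (N + 1) ^ val' x'), add_comm]
  -- off the centre
  have hoffD : ∀ x' ∈ Soff, π.base x' ∉ (D : Set A.Z) := fun x' hx' => by
    rw [hSoff, Finset.mem_filter] at hx'
    rw [hDξ]; exact hx'.2
  have hinj : Set.InjOn π.base (Soff : Set A'.Z) :=
    (MohWindow.injOn_preimage_compl hπ).mono fun x' hx' => hoffD x' hx'
  have himage : Soff.image π.base ⊆ S.erase ξ := by
    intro η hη
    obtain ⟨x', hx', rfl⟩ := Finset.mem_image.mp hη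
    have hx'S : x' ∈ (E.transform π D).sing := (hmemS' x').mp (Finset.mem_filter.mp hx').1
    refine Finset.mem_erase.mpr ⟨?_, ?_⟩
    · have := hoffD x' hx'; rw [hDξ] at this; exact this
    · rw [hS, Set.Finite.mem_toFinset]
      exact MohWindowSurfacePermissible.base_mem_sing_of_not_over_centre π hπ hx'S (hoffD x' hx')
  have hXle : ∑ x' ∈ Soff, (N + 1) ^ val' x' ≤ ∑ x ∈ S.erase ξ, (N + 1) ^ val x :=
    calc ∑ x' ∈ Soff, (N + 1) ^ val' x' = ∑ x' ∈ Soff, (N + 1) ^ val (π.base x') :=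
          Finset.sum_congr rfl fun x' hx' => by rw [hoff x' ((hmemS' x').mp (Finset.mem_filter.mp hx').1) (hoffD x' hx')]
      _ = ∑ x ∈ Soff.image π.base, (N + 1) ^ val x :=
          (Finset.sum_image (f := fun x => (N + 1) ^ val x) fun a ha b hb h => hinj ha hb h).symm
      _ ≤ ∑ x ∈ S.erase ξ, (N + 1) ^ val x := Finset.sum_le_sum_of_subset_of_nonneg himage fun _ _ _ => Nat.zero_le _
  have hSval : ∑ x ∈ S.erase ξ, (N + 1) ^ val x + (N + 1) ^ val ξ = ∑ x ∈ S, (N + 1) ^ val x :=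
    Finset.sum_erase_add S (fun x => (N + 1) ^ val x) hξmem
  -- over the centre: at most `N` points, each of weight `≤ val ξ - 1`
  have hon' : ∑ x' ∈ Son, (N + 1) ^ val' x' + 1 ≤ (N + 1) ^ val ξ := by
    rcases Son.eq_empty_or_nonempty with h | ⟨x₀, hx₀⟩
    · rw [h, Finset.sum_empty, zero_add]; exact Nat.one_le_pow _ _ (Nat.succ_pos N)
    · have hmem : ∀ x' ∈ Son, x' ∈ (E.transform π D).sing ∩ π.base ⁻¹' (D : Set A.Z) := fun x' hx' => by
        have h1 := Finset.mem_filter.mp hx'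
        exact ⟨(hmemS' x').mp h1.1, by rw [Set.mem_preimage, hDξ, h1.2]; exact Set.mem_singleton ξ⟩
      have hcard : Son.card ≤ N := by
        have hsub : Son ⊆ hN.1.toFinset := fun x' hx' => (Set.Finite.mem_toFinset _).mpr (hmem x' hx')
        calc Son.card ≤ hN.1.toFinset.card := Finset.card_le_card hsub
          _ = ((E.transform π D).sing ∩ π.base ⁻¹' (D : Set A.Z)).ncard := (Set.ncard_eq_toFinset_card _ hN.1).symm
          _ ≤ N := hN.2
      have h0 := Finset.mem_filter.mp hx₀
      have hvξ : 1 ≤ val ξ := by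
        have := hon x₀ ((hmemS' x₀).mp h0.1) (by rw [hDξ, h0.2]; exact Set.mem_singleton ξ)
        rw [h0.2] at this; omega
      have hle : ∀ x' ∈ Son, (N + 1) ^ val' x' ≤ (N + 1) ^ (val ξ - 1) := by
        intro x' hx'
        have h1 := Finset.mem_filter.mp hx'
        have hlt := hon x' ((hmemS' x').mp h1.1) (by rw [hDξ, h1.2]; exact Set.mem_singleton ξ)
        rw [h1.2] at hlt
        exact Nat.pow_le_pow_right (Nat.succ_pos N) (by omega)
      have hsum : ∑ x' ∈ Son, (N + 1) ^ val' x' ≤ N * (N + 1) ^ (val ξ - 1) := by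
        have := Finset.sum_le_card_nsmul Son (fun x' => (N + 1) ^ val' x') _ hle
        rw [smul_eq_mul] at this
        exact this.trans (Nat.mul_le_mul_right _ hcard)
      have hM : 1 ≤ (N + 1) ^ (val ξ - 1) := Nat.one_le_pow _ _ (Nat.succ_pos N)
      have hpow : (N + 1) ^ val ξ = (N + 1) * (N + 1) ^ (val ξ - 1) := by
        rw [← pow_succ', Nat.sub_add_cancel hvξ]
      rw [hpow]
      nlinarith
  rw [hsplit, ← hSval]
  omega

/-! ## 2. The potential bound on the length of an in-regime sequence -/

/-- **[OURS · L1 W4.6 rung (iii-2), tame side, every `p`] EVERY PERMISSIBLE SEQUENCE INSIDE THE TAME SURFACE WINDOW HAS LENGTH AT MOST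
THE POTENTIAL OF ITS FIRST STAGE**: for a finite §2.1-permissible sequence all of whose stages lie in `Regime.mohWindowSurfaceTame`,
`len ≤ Σ_{ξ ∈ Sing(E₀)} (4p − 1)^{residualOrder(J_ξ)}` (residual order as a natural number via `toNat`). The potential drops by
`≥ 1` at each step: res-D-pv-050's `residualOrder_lt_of_over_centre` / `residualOrder_eq_of_not_over_centre` and the child count
`ncard_sing_inter_preimage_centre_le` (`N = 2(2p − 1)`). NOT a statement of the manuscript. [folklore] -/
theorem FinPermissibleRun.len_le_potential_of_mohWindowSurfaceTame (r : FinPermissibleRun p K)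
    (hr : ∀ k, k ≤ r.len → Regime.mohWindowSurfaceTame (r.A k) (r.E k)) :
    r.len ≤ ∑ x ∈ (hr 0 (Nat.zero_le _)).2.1.toFinset,
      (2 * (2 * p - 1) + 1) ^ (residualOrder (r.E 0).b ((r.A 0).Z.presheaf.stalk x) (stalkIdeal (r.E 0).J x)).toNat := by
  classical
  let val : (k : ℕ) → (r.A k).Z → ℕ := fun k x =>
    (residualOrder (r.E k).b ((r.A k).Z.presheaf.stalk x) (stalkIdeal (r.E k).J x)).toNat
  let N : ℕ := 2 * (2 * p - 1)
  -- the potential step, stated for an arbitrary next stage `E₁ = transform` (dependent rewriting along `E_succ`)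
  have key : ∀ k (hk : Regime.mohWindowSurfaceTame (r.A k) (r.E k)) (E₁ : IdealExponent (r.A (k + 1)).Z)
      (h₁ : Regime.mohWindowSurfaceTame (r.A (k + 1)) E₁) (heq : E₁ = (r.E k).transform (r.π k) (r.D k))
      (hperm : (r.E k).IsPermissibleCentre (r.A k).hom (r.D k)) (hbl : IsBlowup (r.π k) (vanishingIdeal (r.D k))),
      (∑ x ∈ h₁.2.1.toFinset, (N + 1) ^ (residualOrder E₁.b ((r.A (k + 1)).Z.presheaf.stalk x) (stalkIdeal E₁.J x)).toNat) + 1 ≤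
        ∑ x ∈ hk.2.1.toFinset, (N + 1) ^ val k x := by
    intro k hk E₁ h₁ heq hperm hbl
    subst heq
    exact sum_pow_val_succ_add_one_le (r.π k) hbl hperm hk.2.1 hk.2.2.1 h₁.2.1 _ _
      (fun x' _ hover => congrArg ENat.toNat
        (MohWindowSurfacePermissible.residualOrder_eq_of_not_over_centre (E := r.E k) (r.π k) hbl hover))
      (fun x' hx' hover => MohWindowSurfacePermissible.residualOrder_lt_of_over_centre (r.π k) hbl hperm hk h₁ hx' hover) N
      (ncard_sing_inter_preimage_centre_le (r.π k) hbl hperm (Regime.mohWindowSurfaceTame_le _ _ hk))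
  -- telescoping
  have htel : ∀ k (hk : k ≤ r.len), (∑ x ∈ (hr k hk).2.1.toFinset, (N + 1) ^ val k x) + k ≤
      ∑ x ∈ (hr 0 (Nat.zero_le _)).2.1.toFinset, (N + 1) ^ val 0 x := by
    intro k
    induction k with
    | zero => intro hk; simp
    | succ k ih =>
      intro hk1
      have hk : k ≤ r.len := Nat.le_of_succ_le hk1
      have hklt : k < r.len := hk1
      have hstep : (∑ x ∈ (hr (k + 1) hk1).2.1.toFinset, (N + 1) ^ val (k + 1) x) + 1 ≤
          ∑ x ∈ (hr k hk).2.1.toFinset, (N + 1) ^ val k x :=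
        key k (hr k hk) (r.E (k + 1)) (hr (k + 1) hk1) (r.E_succ k hklt) (r.permissible k hklt) (r.blowup k hklt)
      have := ih hk
      omega
  exact (Nat.le_add_left _ _).trans (htel r.len le_rfl)

/-! ## 3. The residual order in the regime is `< 2p`; a closed-form bound -/

/-- In the coefficient surface-window regime the residual order at a singular point is the window exponent `d ≤ 2p − 1`
(res-D-pv-050's `MohWindowSurface.residualOrder_coeff`). [folklore] -/
theorem residualOrder_toNat_le_of_mohWindowSurface (hRg : Regime.mohWindowSurface A E) {ξ : A.Z} (hξ : ξ ∈ E.sing) :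
    (residualOrder E.b (A.Z.presheaf.stalk ξ) (stalkIdeal E.J ξ)).toNat ≤ 2 * p - 1 := by
  obtain ⟨hb, -, -, hwin⟩ := hRg
  obtain ⟨hRreg, h3, x, y, z, hxyz, d, a, hbd, hd2, hunit, hJ⟩ := hwin ξ hξ
  rw [hb] at hbd hd2 hJ ⊢
  haveI := hRreg
  haveI : CharP (A.Z.presheaf.stalk ξ) p := Lem16p11Proof.charP_stalk A (𝟙 A.Z) ξ
  rw [hJ, MohWindowSurface.residualOrder_coeff p hRreg h3 hxyz hbd hd2 hunit, ENat.toNat_coe]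
  omega

/-- **[OURS · L1 W4.6 rung (iii-2), tame side, every `p`] CLOSED-FORM LENGTH BOUND**: every finite §2.1-permissible sequence inside
`Regime.mohWindowSurfaceTame` has `len ≤ #Sing(E₀) · (4p − 1)^(2p − 1)`. NOT a statement of the manuscript. [folklore] -/
theorem FinPermissibleRun.len_le_ncard_mul_pow_of_mohWindowSurfaceTame (r : FinPermissibleRun p K)
    (hr : ∀ k, k ≤ r.len → Regime.mohWindowSurfaceTame (r.A k) (r.E k)) :
    r.len ≤ (r.E 0).sing.ncard * (2 * (2 * p - 1) + 1) ^ (2 * p - 1) := by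
  classical
  have h0 := hr 0 (Nat.zero_le _)
  refine (FinPermissibleRun.len_le_potential_of_mohWindowSurfaceTame r hr).trans ?_
  rw [Set.ncard_eq_toFinset_card _ h0.2.1]
  have := Finset.sum_le_card_nsmul h0.2.1.toFinset
    (fun x => (2 * (2 * p - 1) + 1) ^ (residualOrder (r.E 0).b ((r.A 0).Z.presheaf.stalk x) (stalkIdeal (r.E 0).J x)).toNat)
    ((2 * (2 * p - 1) + 1) ^ (2 * p - 1)) fun x hx =>
      Nat.pow_le_pow_right (Nat.succ_pos _)
        (residualOrder_toNat_le_of_mohWindowSurface (Regime.mohWindowSurfaceTame_le _ _ h0) ((Set.Finite.mem_toFinset _).mp hx))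
  rwa [smul_eq_mul] at this

/-! ## 4. The exit-bound form of the tame rung, every `p` -/

/-- **[OURS · L1 W4.6 rung (iii-2), tame side, every `p`] THE EXIT-BOUND FORM OF THE TAME SURFACE-WINDOW RUNG HOLDS**:
`FinLocalExitBound (Regime.mohWindowSurfaceTame)` for every prime `p` and every field `K` of characteristic `p`, with the
closed-form witness `β(A, E, x) = #Sing(E) · (4p − 1)^(2p − 1)` — along every finite permissible sequence inside the tame regime at
most `β(A₀, E₀, x)` centres lie over any point (indeed at most that many centres at all,
`FinPermissibleRun.len_le_ncard_mul_pow_of_mohWindowSurfaceTame`). NOT a statement of the manuscript. [folklore] -/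
theorem finLocalExitBound_mohWindowSurfaceTame : FinLocalExitBound (Regime.mohWindowSurfaceTame (p := p) (K := K)) := by
  refine ⟨fun _ E _ => E.sing.ncard * (2 * (2 * p - 1) + 1) ^ (2 * p - 1), fun r hr x s hs => ?_⟩
  have hlen := FinPermissibleRun.len_le_ncard_mul_pow_of_mohWindowSurfaceTame r hr
  have hcard : s.card ≤ r.len := by
    calc s.card ≤ (Finset.range r.len).card :=
          Finset.card_le_card fun m hm => Finset.mem_range.mpr (hs m hm).1
      _ = r.len := Finset.card_range _
  exact hcard.trans hlen

/-- **The perfect-base-field slice**: `FinLocalExitBound (Regime.mohWindowSurfaceTamePerfect)` (o1's `…MohWindowSurfacePerfect.lean`,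
the same regime under `[PerfectField K]`). NOT a statement of the manuscript. [folklore] -/
theorem finLocalExitBound_mohWindowSurfaceTamePerfect [PerfectField K] :
    FinLocalExitBound (Regime.mohWindowSurfaceTamePerfect (p := p) (K := K)) :=
  finLocalExitBound_mohWindowSurfaceTame

end Campaign

end CampaignW46

end Summit.ResolutionOfSingularities.ResolutionOfSingularities.Theorems

end
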